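/- Fleet lead `ym-wcr-19456-p1` (seat g2), route `WeakCouplingRates`, crux `ColdBoxTwoPointFloorW` (stmt-QuantumFields-19608). -/
-- tree-module: Summits.QuantumFields.YangMills.Theorems.WeakCouplingRatesColdBoxLinkSmall
import Summits.QuantumFields.YangMills.Theorems.WeakCouplingRatesColdBoxPlaqChart
import Summits.QuantumFields.YangMills.Theorems.WeakCouplingRatesColdBoxForestPoincare
import Literature.MathematicalPhysics.QuantumFieldTheory.Balaban1983to89.MatrixNorms

/-!
# Crux `ColdBoxTwoPointFloorW`, stub `stub_boxGaussianDomination`, brick R1: SMALL PLAQUETTES ⇒ SMALL LINKS for the `SU(2)` cold-wall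
# box in the temporal-forest gauge

The length function `ℓ U = ‖U − 1‖_op` (`opDist1 ∘ fundamentalRep`, tree `Balaban1983to89.UnitaryModel`) satisfies `ℓ 1 = 0`,
`ℓ(UV) ≤ ℓ U + ℓ V`, `ℓ(U⁻¹) = ℓ U` and, on `SU(2)`, **`ℓ(U)² = 2 − Re tr U`** exactly (`opDist1_sq_eq_of_mem_specialUnitaryGroup_two`).
Hence for a configuration `V` which is `1` off the cold box `Λ = boxEdges 4 (2H+1)` and on the temporal forest and all of whose plaquettes
touching `Λ` cost `≤ δ²`:
* `ell_hol_le_of_cost_le` — every plaquette holonomy (all `x i j`, including degenerate and reversed ones and plaquettes off the box) has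
  `ℓ ≤ δ`;
* **`linkCost_le_of_plaqCost_le`** — by the forest Poincaré ladder `ell_le_uniform` (`…ColdBoxForestPoincare`, p448019) every link costs
  `2 − Re tr V_e ≤ ((12H² + 2H + 1)·δ)²`;
* **`sum_sq_extZero_le_of_plaqCost_le`** — for the chart configuration `chartCfg w`: every chart coordinate has
  `Σ_k v_e,k² ≤ 2((12H²+2H+1)δ)²` once `((12H²+2H+1)δ)² ≤ ½` — the sup-norm link bound `η` of the one-scale expansion on the small-field
  event (`δ² = β^{2ε−1}`, `H = ⌈β^θ⌉`: `η ≍ H²β^{ε−1/2} → 0` iff `2θ + ε < ½`).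
No sorry; no new definition; standard axioms.  NOT a claim about the mass gap.
-/

set_option autoImplicit false

noncomputable section

open Finset
open scoped Matrix.Norms.L2Operator
open Literature.Probability.LatticeModels (Site)
open Literature.MathematicalPhysics.QuantumLattice
open Literature.MathematicalPhysics.QuantumFieldTheory
open Literature.MathematicalPhysics.QuantumFieldTheory.LatticeMaxwell
open Literature.MathematicalPhysics.QuantumFieldTheory.AxialGauge
open Literature.MathematicalPhysics.QuantumFieldTheory.Balaban1983to89
open Literature.MathematicalPhysics.QuantumFieldTheory.Balaban1983to89.UnitaryModel

namespace Summit.QuantumFields.YangMills.Theorems.WeakCouplingRates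

variable {H : ℕ}

/-! ## The operator-norm length function on `SU(2)` -/

/-- **`ℓ(U)² = 2 − Re tr U` on `SU(2)`** for `ℓ = ‖· − 1‖_op`. -/
theorem opDist1_fundamentalRep_sq (U : Matrix.specialUnitaryGroup (Fin 2) ℂ) :
    opDist1 (fundamentalRep (Fin 2) U) ^ 2 = 2 - ((U : Matrix (Fin 2) (Fin 2) ℂ).trace).re := by
  rw [fundamentalRep_apply, MatrixNorms.opDist1_sq_eq_of_mem_specialUnitaryGroup_two U.2, nReTr]
  simp only [Fintype.card_fin, Nat.cast_ofNat]
  ring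

/-- `ℓ(U) ≤ δ` when the cost `2 − Re tr U ≤ δ²` (`δ ≥ 0`). -/
theorem opDist1_fundamentalRep_le_of_cost_le {U : Matrix.specialUnitaryGroup (Fin 2) ℂ} {δ : ℝ} (hδ : 0 ≤ δ)
    (h : 2 - ((U : Matrix (Fin 2) (Fin 2) ℂ).trace).re ≤ δ ^ 2) : opDist1 (fundamentalRep (Fin 2) U) ≤ δ := by
  rw [← opDist1_fundamentalRep_sq] at h
  exact (pow_le_pow_iff_left₀ (opDist1_nonneg _) hδ two_ne_zero).1 h

/-- Conversely the cost is `ℓ²`: `2 − Re tr U ≤ η²` when `ℓ(U) ≤ η`. -/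
theorem cost_le_of_opDist1_fundamentalRep_le {U : Matrix.specialUnitaryGroup (Fin 2) ℂ} {η : ℝ}
    (h : opDist1 (fundamentalRep (Fin 2) U) ≤ η) : 2 - ((U : Matrix (Fin 2) (Fin 2) ℂ).trace).re ≤ η ^ 2 := by
  rw [← opDist1_fundamentalRep_sq]
  exact pow_le_pow_left₀ (opDist1_nonneg _) h 2

/-! ## Small plaquettes ⇒ small links -/

/-- A plaquette all of whose edges are off the cold box has trivial holonomy for a configuration that is `1` off the box. -/
theorem plaquetteHolonomyZd_eq_one_of_not_touching {G : Type*} [Group G] (V : LGConfig 4 G)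
    (hout : ∀ e, e ∉ boxEdges 4 (2 * H + 1) → V e = 1) {x : Site 4} {i j : Fin 4} (hij : i < j)
    (hp : ((x, ⟨(i, j), hij⟩) : ZdPlaquette 4) ∉ plaquettesTouching (boxEdges 4 (2 * H + 1))) :
    plaquetteHolonomyZd V x i j = 1 := by
  rw [mem_plaquettesTouching_iff, Finset.not_nonempty_iff_eq_empty] at hp
  have hnot : ∀ e ∈ plaquetteEdges ((x, ⟨(i, j), hij⟩) : ZdPlaquette 4), e ∉ boxEdges 4 (2 * H + 1) := fun e he hmem => by
    have : e ∈ plaquetteEdges ((x, ⟨(i, j), hij⟩) : ZdPlaquette 4) ∩ boxEdges 4 (2 * H + 1) := Finset.mem_inter.2 ⟨he, hmem⟩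
    rw [hp] at this; simp at this
  have h1 := hout _ (hnot (x, i) (by simp [plaquetteEdges]))
  have h2 := hout _ (hnot (x + Pi.single i 1, j) (by simp [plaquetteEdges]))
  have h3 := hout _ (hnot (x + Pi.single j 1, i) (by simp [plaquetteEdges]))
  have h4 := hout _ (hnot (x, j) (by simp [plaquetteEdges]))
  simp [plaquetteHolonomyZd, h1, h2, h3, h4]

/-- Reversing the plane inverts the plaquette holonomy. -/
theorem plaquetteHolonomyZd_swap {G : Type*} [Group G] (V : LGConfig 4 G) (x : Site 4) (i j : Fin 4) :
    plaquetteHolonomyZd V x j i = (plaquetteHolonomyZd V x i j)⁻¹ := by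
  simp only [plaquetteHolonomyZd, mul_inv_rev, inv_inv, mul_assoc]

/-- **Every plaquette holonomy is `ℓ`-small** if every plaquette touching the cold box costs `≤ δ²` and the configuration is `1` off the
box (degenerate plaquettes and plaquettes off the box are `1`; reversed plaquettes are inverses). -/
theorem ell_hol_le_of_cost_le (V : LGConfig 4 (Matrix.specialUnitaryGroup (Fin 2) ℂ))
    (hout : ∀ e, e ∉ boxEdges 4 (2 * H + 1) → V e = 1) {δ : ℝ} (hδ : 0 ≤ δ)
    (hcost : ∀ p ∈ plaquettesTouching (boxEdges 4 (2 * H + 1)),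
      plaqCostAt (fundamentalRep (Fin 2)) p.1 p.2.1.1 p.2.1.2 V ≤ δ ^ 2)
    (x : Site 4) (i j : Fin 4) : opDist1 (fundamentalRep (Fin 2) (plaquetteHolonomyZd V x i j)) ≤ δ := by
  -- the case `i < j`
  have hlt : ∀ i j : Fin 4, i < j → opDist1 (fundamentalRep (Fin 2) (plaquetteHolonomyZd V x i j)) ≤ δ := by
    intro i j hij
    by_cases hp : ((x, ⟨(i, j), hij⟩) : ZdPlaquette 4) ∈ plaquettesTouching (boxEdges 4 (2 * H + 1))
    · have h := hcost _ hp
      rw [plaqCostAt_eq_two_sub_trace] at h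
      exact opDist1_fundamentalRep_le_of_cost_le hδ h
    · rw [plaquetteHolonomyZd_eq_one_of_not_touching V hout hij hp, map_one, opDist1_one]
      exact hδ
  rcases lt_trichotomy i j with hij | rfl | hji
  · exact hlt i j hij
  · have : plaquetteHolonomyZd V x i i = 1 := by simp [plaquetteHolonomyZd]
    rw [this, map_one, opDist1_one]; exact hδ
  · rw [plaquetteHolonomyZd_swap, opDist1_map_inv _ fundamentalRep_mem_unitaryGroup]
    exact hlt j i hji

/-- **Small plaquettes ⇒ small links** (forest Poincaré ladder, p448019): if `V` is `1` off the cold box and on the temporal forest and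
every plaquette touching the box costs `≤ δ²` (`δ ≥ 0`, `H ≥ 1`), then every link costs `2 − Re tr V_e ≤ ((12H² + 2H + 1)·δ)²`. -/
theorem linkCost_le_of_plaqCost_le (hH : 1 ≤ H) (V : LGConfig 4 (Matrix.specialUnitaryGroup (Fin 2) ℂ))
    (hout : ∀ e, e ∉ boxEdges 4 (2 * H + 1) → V e = 1)
    (hforest : ∀ x : Site 4, (∀ k : Fin 4, 1 ≤ x k ∧ x k + 1 ≤ 2 * (H : ℤ)) → V (x, 0) = 1) {δ : ℝ} (hδ : 0 ≤ δ)
    (hcost : ∀ p ∈ plaquettesTouching (boxEdges 4 (2 * H + 1)),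
      plaqCostAt (fundamentalRep (Fin 2)) p.1 p.2.1.1 p.2.1.2 V ≤ δ ^ 2)
    (e : Literature.MathematicalPhysics.QuantumLattice.ZdEdge 4) :
    2 - (((V e : Matrix.specialUnitaryGroup (Fin 2) ℂ) : Matrix (Fin 2) (Fin 2) ℂ).trace).re ≤ ((12 * (H : ℝ) ^ 2 + 2 * H + 1) * δ) ^ 2 := by
  have h := ell_le_uniform (fun U : Matrix.specialUnitaryGroup (Fin 2) ℂ => opDist1 (fundamentalRep (Fin 2) U))
    (by rw [map_one, opDist1_one])
    (fun U U' => opDist1_map_mul_le _ fundamentalRep_mem_unitaryGroup U U')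
    (fun U => opDist1_map_inv _ fundamentalRep_mem_unitaryGroup U) V hout hforest
    (M := δ) (ell_hol_le_of_cost_le V hout hδ hcost) hH e
  exact cost_le_of_opDist1_fundamentalRep_le h

/-- **The sup-norm chart-coordinate bound on the small-field event**: for the chart configuration `chartCfg w` (automatically `1` off
the box and on the forest), if every plaquette touching the box costs `≤ δ²` and `((12H²+2H+1)δ)² ≤ ½`, then every chart coordinate
has `Σ_k v_e,k² ≤ 2·((12H²+2H+1)δ)²`. -/
theorem sum_sq_extZero_le_of_plaqCost_le (hH : 1 ≤ H) (w : ColdFreeIdx H → (Fin 3 → ℝ)) {δ : ℝ} (hδ : 0 ≤ δ)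
    (hsmall : ((12 * (H : ℝ) ^ 2 + 2 * H + 1) * δ) ^ 2 ≤ 1 / 2)
    (hcost : ∀ p ∈ plaquettesTouching (boxEdges 4 (2 * H + 1)),
      plaqCostAt (fundamentalRep (Fin 2)) p.1 p.2.1.1 p.2.1.2 (chartCfg w) ≤ δ ^ 2)
    (e : Literature.MathematicalPhysics.QuantumLattice.ZdEdge 4) :
    ∑ k, extZero w e k ^ 2 ≤ 2 * ((12 * (H : ℝ) ^ 2 + 2 * H + 1) * δ) ^ 2 :=
  sum_sq_extZero_le_two_mul_linkCost w e hsmall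
    (linkCost_le_of_plaqCost_le hH (chartCfg w) (fun _ he => chartCfg_of_not_mem w he) (fun _ hx => chartCfg_of_forest w hx)
      hδ hcost e)

/-- The same bound from STRICT cost inequalities `< δ²` (the form of `coldGoodSet`). -/
theorem sum_sq_extZero_le_of_plaqCost_lt (hH : 1 ≤ H) (w : ColdFreeIdx H → (Fin 3 → ℝ)) {δ : ℝ} (hδ : 0 ≤ δ)
    (hsmall : ((12 * (H : ℝ) ^ 2 + 2 * H + 1) * δ) ^ 2 ≤ 1 / 2)
    (hcost : ∀ p ∈ plaquettesTouching (boxEdges 4 (2 * H + 1)),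
      plaqCostAt (fundamentalRep (Fin 2)) p.1 p.2.1.1 p.2.1.2 (chartCfg w) < δ ^ 2)
    (e : Literature.MathematicalPhysics.QuantumLattice.ZdEdge 4) :
    ∑ k, extZero w e k ^ 2 ≤ 2 * ((12 * (H : ℝ) ^ 2 + 2 * H + 1) * δ) ^ 2 :=
  sum_sq_extZero_le_of_plaqCost_le hH w hδ hsmall (fun p hp => (hcost p hp).le) e

/-- **Reading `coldGoodSet` on the chart configuration**: `chartCfg w ∈ coldGoodSet β ε H` iff every plaquette touching the box costs
`< β^{2ε−1}`. -/
theorem chartCfg_mem_coldGoodSet_iff (β ε : ℝ) (w : ColdFreeIdx H → (Fin 3 → ℝ)) :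
    chartCfg w ∈ coldGoodSet β ε H ↔ ∀ p ∈ plaquettesTouching (boxEdges 4 (2 * H + 1)),
      plaqCostAt (fundamentalRep (Fin 2)) p.1 p.2.1.1 p.2.1.2 (chartCfg w) < β ^ (2 * ε - 1) := by
  simp only [coldGoodSet, Set.mem_compl_iff, Set.mem_setOf_eq, not_exists, not_and, not_le, plaqCostAt, Nat.cast_ofNat]

end Summit.QuantumFields.YangMills.Theorems.WeakCouplingRates

end
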